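import Literature.Analysis.FluidPDE.LocalPressureOscillationTools
import Literature.Analysis.FluidPDE.LocalPressureLiouvilleFunctional
import Literature.Analysis.FluidPDE.LerayPressureDecayProofs
import Literature.Analysis.FluidPDE.HelmholtzAnnihilator
import HarnessLib

/-!
# The pressure oscillation estimate on a time slice, from the mollified pressure-gradient
identities (local Leray solutions on a slab)

Analysis/FluidPDE support file (theorems only, everything PROVED) on the discharge path of the
named fact `Literature.Analysis.FluidPDE.kangMiuraTsai_local_pressure_bound`
(`LocalLerayPressureBound.lean`; Kang–Miura–Tsai, IMRN 2021 = arXiv:1812.10509, §8, proof of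
Lemma 3.4: "`‖p_loc‖ + ‖p_far‖ ≤ cA + …`", with "By the Calderon–Zygmund estimate,
`∫ |p_loc|^q ≤ c_q ∫ |v|^{2q}`" and "`|p_far(x,t)| ≤ ∫_{2R<|y-x₀|} cR|x₀-y|⁻⁴|v(y,t)|² dy`").

**The slice theorem** (`slice_pressure_oscillation_le`). Let `w : ℝ³ → ℝ³` be a uniformly locally
`L²` field and `p ∈ L¹_loc(ℝ³)` satisfy, for every `δ = 1/(n+1)`, every centre `c` and every
direction `e`, the identity
`∫ [p(x) ∂ₑλ_δ(c - x) + D³Φ_δ(c - x)(e)(w x, w x)] dx = 0`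
(the output of the Liouville step on a.e. time slice of a local Leray solution,
`IsLocalLeraySolutionOn.ae_slice_pgIdentity`, `LocalPressureLiouville.lean`). Then for every ball
`B_r(x₀)` there is a constant `κ` with

  `∫_{B_r(x₀)} |p - κ|^{3/2} ≤ 2^{1/2} [ C ∫_{B_{2(r+1)}(x₀)} |w|³
      + |B_r| (C_K (r+1) ∫_{|y-x₀| ≥ 2(r+1)} |w(y)|² |y-x₀|⁻⁴ dy)^{3/2} ]`.

*Proof.* The identity says that the gradient of the smooth function `q_δ = λ_δ ⋆ p` is minus the
gradient of the renormalised potential `𝒢_δ(c) = ∫ (D²Φ_δ(c-y) - D²Φ_δ(x₀-y))(w,w) dy`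
(`fderiv_integral_evalDiag_fderiv2_newtonReg_sub_apply`), so `q_δ + 𝒢_δ` is constant on `ℝ³`.
Off the ball `S = B_{2(r+1)}(x₀)` and for `c ∈ B_r(x₀)` the kernel difference is exactly
`-(K(c-y) - K(x₀-y))(w y)` (`Φ_δ = Γ` off `B̄(0,δ)`), i.e. the far field of the local pressure
expansion (`localPressureFar`, pointwise bound `enorm_localPressureFar_le`); on `S` it is the
regularised near field, bounded in `L^{3/2}` uniformly in `δ` by Calderón–Zygmund
(`exists_eLpNorm_nearField_le`). As `δ → 0`, `q_δ → p` a.e. (Lebesgue points,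
`ae_tendsto_laplacian_newtonReg_convolution`); the constants stay bounded (the `L¹` bound on
balls), so along a subsequence they converge, and Fatou's lemma gives the estimate. The mean
gauge then costs a factor `4` (`setLIntegral_rpow_sub_average_le_of_const`, in the assembly file).

## Mathlib / tree search

Tree: `LocalPressureOscillationTools` (near field, mollifiers), `LocalPressureLiouvilleKernel`
(renormalised potential), `localPressureFar`, `enorm_localPressureFar_le`,
`exists_abs_pressureKernel_sub_le`, `add_rpow_threeHalves_le`, `lintegral_rpow_threeHalves_eq`,
`enorm_norm_sq_rpow_threeHalves` (`LerayPressureDecayProofs`), `fderiv_convolution_lsmul_apply`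
(`HelmholtzAnnihilator`). Mathlib: `is_const_of_fderiv_eq_zero`, `tendsto_subseq_of_bounded`,
`lintegral_liminf_le'`, `integral_add_compl`, `integral_sub_left_eq_self`,
`ENNReal.lintegral_mul_le_Lp_mul_Lq`.

## References

* K. Kang, H. Miura, T.-P. Tsai, IMRN 2021 = arXiv:1812.10509, Lemma 3.4 and §8.
  [`KangMiuraTsai2020`]
* H. Jia, V. Šverák, Invent. Math. 196 (2014) = arXiv:1204.0529, §3. [`JiaSverak2014`]
-/

noncomputable section

open MeasureTheory Set Filter Topology Function Metric
open scoped ENNReal NNReal RealInnerProductSpace Laplacian Convolution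

namespace Literature.Analysis.FluidPDE

-- nested operator types `ℝ³ →L[ℝ] ℝ³ →L[ℝ] ℝ³ →L[ℝ] ℝ`
set_option maxSynthPendingDepth 3

section Slice

variable {w : EuclideanSpace ℝ (Fin 3) → EuclideanSpace ℝ (Fin 3)} {p : EuclideanSpace ℝ (Fin 3) → ℝ}
  {A : ℝ≥0∞} {δ : ℝ}

/-- **The gradient of the mollified pressure** `q_δ = λ_δ ⋆ p`:
`∂ₑ q_δ(c) = ∫ p(x) ∂ₑλ_δ(c - x) dx`. [folklore] -/
theorem fderiv_laplacian_newtonReg_convolution_apply (hδ : 0 < δ) (hp : LocallyIntegrable p volume)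
    (c e : EuclideanSpace ℝ (Fin 3)) :
    fderiv ℝ (Δ (newtonReg δ) ⋆[ContinuousLinearMap.lsmul ℝ ℝ, volume] p) c e =
      ∫ x, p x * fderiv ℝ (Δ (newtonReg δ)) (c - x) e := by
  obtain ⟨hlc, hls, hli, hl0⟩ := laplacian_newtonReg_props hδ
  rw [fderiv_convolution_lsmul_apply (contDiff_laplacian_newtonReg hδ (n := 1)) hls hp c e,
    convolution_lsmul_apply]
  have h := integral_sub_left_eq_self (fun t => fderiv ℝ (Δ (newtonReg δ)) t e * p (c - t)) volume c
  simp only [sub_sub_cancel] at h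
  rw [← h]
  exact integral_congr_ae (Eventually.of_forall fun x => mul_comm _ _)

/-- `q_δ = λ_δ ⋆ p` is `C¹`. [folklore] -/
theorem contDiff_laplacian_newtonReg_convolution (hδ : 0 < δ) (hp : LocallyIntegrable p volume) :
    ContDiff ℝ 1 (Δ (newtonReg δ) ⋆[ContinuousLinearMap.lsmul ℝ ℝ, volume] p) :=
  (laplacian_newtonReg_props hδ).2.1.contDiff_convolution_left _
    (contDiff_laplacian_newtonReg hδ (n := 1)) hp

variable (hw : AEStronglyMeasurable w volume) (hAtop : A ≠ ⊤)
  (hA : ∀ z : EuclideanSpace ℝ (Fin 3), ∫⁻ y in ball z 1, ‖w y‖ₑ ^ 2 ≤ A)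
  (hp : LocallyIntegrable p volume)

include hw hAtop hA hp

/-- **Constancy.** If the slice identity holds at scale `δ` for all centres and directions, then
`q_δ + 𝒢_δ` is constant: `q_δ(c) + 𝒢_δ(c) = q_δ(x₀)` for all `c`
(`𝒢_δ(c) = ∫ (D²Φ_δ(c-y) - D²Φ_δ(x₀-y))(w,w) dy`, `𝒢_δ(x₀) = 0`). [folklore] -/
theorem laplacian_newtonReg_convolution_add_potential_eq (hδ : 0 < δ)
    (hid : ∀ c e : EuclideanSpace ℝ (Fin 3),
      ∫ x, (p x * fderiv ℝ (Δ (newtonReg δ)) (c - x) e +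
        evalDiag (w x) (fderiv ℝ (fderiv ℝ (fderiv ℝ (newtonReg δ))) (c - x) e)) = 0)
    (x₀ c : EuclideanSpace ℝ (Fin 3)) :
    (Δ (newtonReg δ) ⋆[ContinuousLinearMap.lsmul ℝ ℝ, volume] p) c +
        ∫ y, evalDiag (w y) (fderiv ℝ (fderiv ℝ (newtonReg δ)) (c - y) -
          fderiv ℝ (fderiv ℝ (newtonReg δ)) (x₀ - y)) =
      (Δ (newtonReg δ) ⋆[ContinuousLinearMap.lsmul ℝ ℝ, volume] p) x₀ := by
  set q := Δ (newtonReg δ) ⋆[ContinuousLinearMap.lsmul ℝ ℝ, volume] p with hq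
  set G : EuclideanSpace ℝ (Fin 3) → ℝ := fun c => ∫ y, evalDiag (w y)
    (fderiv ℝ (fderiv ℝ (newtonReg δ)) (c - y) - fderiv ℝ (fderiv ℝ (newtonReg δ)) (x₀ - y)) with hG
  have hqd : Differentiable ℝ q := (contDiff_laplacian_newtonReg_convolution hδ hp).differentiable one_ne_zero
  have hGd : Differentiable ℝ G := fun c =>
    (hasFDerivAt_integral_evalDiag_fderiv2_newtonReg_sub hδ hw hAtop hA x₀ c).differentiableAt
  have hzero : ∀ c, fderiv ℝ (q + G) c = 0 := by
    intro c
    ext e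
    rw [fderiv_add (hqd c) (hGd c), _root_.add_apply, _root_.zero_apply,
      hq, fderiv_laplacian_newtonReg_convolution_apply hδ hp c e, hG,
      fderiv_integral_evalDiag_fderiv2_newtonReg_sub_apply hδ hw hAtop hA x₀ c e,
      ← integral_add]
    · exact hid c e
    · have hcont : Continuous fun x : EuclideanSpace ℝ (Fin 3) =>
          fderiv ℝ (Δ (newtonReg δ)) (c - x) e :=
        (((contDiff_laplacian_newtonReg hδ (n := 1)).continuous_fderiv one_ne_zero).comp
          (continuous_const.sub continuous_id)).clm_apply continuous_const
      have hsupp : HasCompactSupport fun x : EuclideanSpace ℝ (Fin 3) =>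
          fderiv ℝ (Δ (newtonReg δ)) (c - x) e := by
        refine HasCompactSupport.intro (isCompact_closedBall c δ) fun x hx => ?_
        rw [mem_closedBall, dist_eq_norm, not_le, ← norm_sub_rev] at hx
        rw [fderiv_laplacian_newtonReg_eq_zero hδ hx, _root_.zero_apply]
      have h := hp.integrable_smul_right_of_hasCompactSupport hcont hsupp
      simpa only [smul_eq_mul] using h
    · exact integrable_evalDiag_fderiv3_newtonReg hδ hw hAtop hA c e
  have hconst := is_const_of_fderiv_eq_zero (hqd.add hGd) hzero c x₀
  simp only [Pi.add_apply] at hconst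
  have hG0 : G x₀ = 0 := by
    rw [hG]
    simp
  rw [hG0, add_zero] at hconst
  exact hconst

omit hw hAtop hA hp in
/-- **The near/far splitting of the renormalised potential.** For `S = B_{2k}(x₀)`, `δ ≤ 1 ≤ k`,
`c ∈ B_r(x₀)` with `r + 1 ≤ k`, and a field `w` with `|1_S w|² ∈ L¹`,
`𝒢_δ(c) = N_δ(c) - N_δ(x₀) - p_far(c)`, where `N_δ(c) = ∫ D²Φ_δ(c-y)(1_S w, 1_S w)` is the
regularised near field and `p_far = localPressureFar x₀ k w` the far field of the local pressure
expansion (off `S`, `D²Φ_δ = -K`). [cite: KangMiuraTsai2020, Lemma 3.4 (π_far) and §8] -/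
theorem potential_eq_near_sub_far (hw : AEStronglyMeasurable w volume) (hAtop : A ≠ ⊤)
    (hA : ∀ z : EuclideanSpace ℝ (Fin 3), ∫⁻ y in ball z 1, ‖w y‖ₑ ^ 2 ≤ A) (hδ : 0 < δ) (hδ1 : δ ≤ 1)
    (x₀ : EuclideanSpace ℝ (Fin 3)) {r k : ℝ} (hr : 0 < r) (hk : r + 1 ≤ k)
    (hWi : Integrable (fun y => ‖(ball x₀ (2 * k)).indicator w y‖ ^ 2) volume)
    {c : EuclideanSpace ℝ (Fin 3)} (hc : c ∈ ball x₀ r) :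
    ∫ y, evalDiag (w y) (fderiv ℝ (fderiv ℝ (newtonReg δ)) (c - y) -
        fderiv ℝ (fderiv ℝ (newtonReg δ)) (x₀ - y)) =
      (∫ y, evalDiag ((ball x₀ (2 * k)).indicator w y) (fderiv ℝ (fderiv ℝ (newtonReg δ)) (c - y))) -
        (∫ y, evalDiag ((ball x₀ (2 * k)).indicator w y) (fderiv ℝ (fderiv ℝ (newtonReg δ)) (x₀ - y))) -
        localPressureFar x₀ k (fun _ => w) 0 c := by
  set S : Set (EuclideanSpace ℝ (Fin 3)) := ball x₀ (2 * k) with hS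
  set W : EuclideanSpace ℝ (Fin 3) → EuclideanSpace ℝ (Fin 3) := S.indicator w with hW
  set H : EuclideanSpace ℝ (Fin 3) → EuclideanSpace ℝ (Fin 3) →L[ℝ] EuclideanSpace ℝ (Fin 3) →L[ℝ] ℝ :=
    fderiv ℝ (fderiv ℝ (newtonReg δ)) with hH
  obtain ⟨M₀, M₁, M₂, hM₀, -, -⟩ := exists_bounds_fderiv2_newtonReg hδ
  have hint := integrable_evalDiag_fderiv2_newtonReg_sub hδ hw hAtop hA x₀ c
  rw [← integral_add_compl (measurableSet_ball (x := x₀) (ε := 2 * k)) hint]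
  -- integrability of `y ↦ H(a - y)(W y, W y)` for every `a`
  have hWm : AEStronglyMeasurable W volume := hw.indicator measurableSet_ball
  have hIa : ∀ a : EuclideanSpace ℝ (Fin 3), Integrable (fun y => evalDiag (W y) (H (a - y))) volume := by
    intro a
    refine Integrable.mono' (hWi.mul_const M₀) (aestronglyMeasurable_evalDiag_apply hWm
      (((contDiff_fderiv2_newtonReg δ).continuous.comp (continuous_const.sub continuous_id)).aestronglyMeasurable))
      (Eventually.of_forall fun y => ?_)
    calc ‖evalDiag (W y) (H (a - y))‖ ≤ ‖evalDiag (W y)‖ * ‖H (a - y)‖ := ContinuousLinearMap.le_opNorm _ _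
      _ ≤ ‖W y‖ ^ 2 * M₀ := mul_le_mul (norm_evalDiag_le _) (hM₀ _) (norm_nonneg _) (by positivity)
  -- the near part
  have hnear : ∫ y in S, evalDiag (w y) (H (c - y) - H (x₀ - y)) =
      (∫ y, evalDiag (W y) (H (c - y))) - ∫ y, evalDiag (W y) (H (x₀ - y)) := by
    rw [← integral_sub (hIa c) (hIa x₀)]
    have h1 : ∫ y in S, evalDiag (w y) (H (c - y) - H (x₀ - y)) =
        ∫ y in S, evalDiag (W y) (H (c - y) - H (x₀ - y)) :=
      setIntegral_congr_fun measurableSet_ball fun y hy => by rw [hW, indicator_of_mem hy]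
    rw [h1, setIntegral_eq_integral_of_forall_compl_eq_zero fun y hy => by
      rw [hW, indicator_of_notMem hy]; simp]
    refine integral_congr_ae (Eventually.of_forall fun y => ?_)
    simp only [map_sub]
  -- the far part
  have hfar : ∫ y in Sᶜ, evalDiag (w y) (H (c - y) - H (x₀ - y)) = -localPressureFar x₀ k (fun _ => w) 0 c := by
    rw [localPressureFar_apply, ← integral_neg]
    refine setIntegral_congr_fun measurableSet_ball.compl fun y hy => ?_
    have hy' : 2 * k ≤ ‖y - x₀‖ := by
      rw [mem_compl_iff, mem_ball, dist_eq_norm, not_lt] at hy; exact hy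
    have hcx : ‖c - x₀‖ < r := by rw [← dist_eq_norm]; exact hc
    have h1 : δ < ‖c - y‖ := by
      have : ‖y - x₀‖ ≤ ‖y - c‖ + ‖c - x₀‖ := norm_sub_le_norm_sub_add_norm_sub _ _ _
      rw [norm_sub_rev y c] at this
      linarith
    have h2 : δ < ‖x₀ - y‖ := by rw [norm_sub_rev]; linarith
    rw [hH, evalDiag_fderiv2_newtonReg_sub_eq hδ h1 h2]
  rw [hnear, hfar]
  ring

omit hw hAtop hA hp in
/-- **The pressure oscillation estimate on a slice.** See the module docstring.
[cite: KangMiuraTsai2020, §8 proof of Lemma 3.4 (bounds for p_loc and p_far)] -/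
theorem slice_pressure_oscillation_le :
    ∃ (CN : ℝ≥0) (CK : ℝ), 0 ≤ CK ∧
      ∀ (w : EuclideanSpace ℝ (Fin 3) → EuclideanSpace ℝ (Fin 3)) (A : ℝ≥0∞)
        (p : EuclideanSpace ℝ (Fin 3) → ℝ), AEStronglyMeasurable w volume → A ≠ ⊤ →
        (∀ z : EuclideanSpace ℝ (Fin 3), ∫⁻ y in ball z 1, ‖w y‖ₑ ^ 2 ≤ A) →
        LocallyIntegrable p volume →
        (∀ (n : ℕ) (c e : EuclideanSpace ℝ (Fin 3)),
          ∫ x, (p x * fderiv ℝ (Δ (newtonReg ((n : ℝ) + 1)⁻¹)) (c - x) e +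
            evalDiag (w x) (fderiv ℝ (fderiv ℝ (fderiv ℝ (newtonReg ((n : ℝ) + 1)⁻¹))) (c - x) e)) = 0) →
        ∀ (x₀ : EuclideanSpace ℝ (Fin 3)) (r : ℝ), 0 < r →
          ∃ κ : ℝ, ∫⁻ c in ball x₀ r, ‖p c - κ‖ₑ ^ (3 / 2 : ℝ) ≤
            (2 : ℝ≥0∞) ^ (1 / 2 : ℝ) *
              ((CN : ℝ≥0∞) ^ (3 / 2 : ℝ) * (∫⁻ y in ball x₀ (2 * (r + 1)), ‖w y‖ₑ ^ (3 : ℕ)) +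
                volume (ball x₀ r) * (ENNReal.ofReal (CK * (r + 1)) *
                  ∫⁻ y in (ball x₀ (2 * (r + 1)))ᶜ,
                    ‖w y‖ₑ ^ (2 : ℕ) * RieszKernel.powKer 4 (y - x₀)) ^ (3 / 2 : ℝ)) := by
  obtain ⟨CN₀, hCN₀⟩ := exists_eLpNorm_nearField_le
  obtain ⟨CK, hCK0, hCK⟩ := exists_abs_pressureKernel_sub_le
  refine ⟨CN₀ + 1, CK, hCK0, fun w A p hw hAtop hA hp hid x₀ r hr => ?_⟩
  set CN : ℝ≥0 := CN₀ + 1 with hCNdef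
  have hCN : ∀ δ : ℝ, 0 < δ → ∀ (x₀ : EuclideanSpace ℝ (Fin 3)) (R : ℝ)
      (w : EuclideanSpace ℝ (Fin 3) → EuclideanSpace ℝ (Fin 3)), AEStronglyMeasurable w volume →
      (∀ x, x ∉ ball x₀ R → w x = 0) → MemLp (fun x => ‖w x‖ ^ 2) (3 / 2) volume →
        eLpNorm (fun c => ∫ y, evalDiag (w y) (fderiv ℝ (fderiv ℝ (newtonReg δ)) (c - y))) (3 / 2) volume ≤
          CN * eLpNorm (fun x => ‖w x‖ ^ 2) (3 / 2) volume := fun δ hδ x₀ R w hw hS hw2 =>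
    (hCN₀ δ hδ x₀ R w hw hS hw2).trans (mul_le_mul' (by rw [hCNdef]; exact_mod_cast le_self_add) le_rfl)
  have hCNpos : (0 : ℝ≥0∞) < CN := by
    rw [hCNdef]; exact ENNReal.coe_pos.2 (add_pos_of_nonneg_of_pos bot_le one_pos)
  -- radii and sets
  set k : ℝ := r + 1 with hk
  have hk0 : 0 < k := by linarith
  have hk2 : (2 : ℝ) ≤ 2 * k := by linarith
  set S : Set (EuclideanSpace ℝ (Fin 3)) := ball x₀ (2 * k) with hS
  set Br : Set (EuclideanSpace ℝ (Fin 3)) := ball x₀ r with hBr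
  set μr : Measure (EuclideanSpace ℝ (Fin 3)) := volume.restrict Br with hμr
  set I3 : ℝ≥0∞ := ∫⁻ y in S, ‖w y‖ₑ ^ (3 : ℕ) with hI3
  set Tail : ℝ≥0∞ := ∫⁻ y in Sᶜ, ‖w y‖ₑ ^ (2 : ℕ) * RieszKernel.powKer 4 (y - x₀) with hTail
  set RHS : ℝ≥0∞ := (2 : ℝ≥0∞) ^ (1 / 2 : ℝ) * ((CN : ℝ≥0∞) ^ (3 / 2 : ℝ) * I3 +
    volume Br * (ENNReal.ofReal (CK * k) * Tail) ^ (3 / 2 : ℝ)) with hRHS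
  show ∃ κ : ℝ, ∫⁻ c in Br, ‖p c - κ‖ₑ ^ (3 / 2 : ℝ) ≤ RHS
  -- the trivial case `∫_S |w|³ = ∞`
  by_cases hI3top : I3 = ⊤
  · refine ⟨0, le_of_le_of_eq le_top ?_⟩
    rw [hRHS, hI3top, ENNReal.mul_top (ENNReal.rpow_pos hCNpos ENNReal.coe_ne_top).ne', top_add,
      ENNReal.mul_top]
    exact (ENNReal.rpow_pos (by norm_num) (by norm_num)).ne'
  -- finiteness of the tail
  have hTail_le : Tail ≤ (volume (ball (0 : EuclideanSpace ℝ (Fin 3)) 1))⁻¹ *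
      (A * (16 * ∫⁻ z in (ball (0 : EuclideanSpace ℝ (Fin 3)) (2 * k - 1))ᶜ, RieszKernel.powKer 4 z)) :=
    lintegral_compl_ball_mul_powKer_le (hw.enorm.pow_const _) hA x₀ hk2
  have hTailtop : Tail ≠ ⊤ := by
    refine ne_top_of_le_ne_top ?_ hTail_le
    refine ENNReal.mul_ne_top (ENNReal.inv_ne_top.2 (measure_ball_pos volume _ one_pos).ne')
      (ENNReal.mul_ne_top hAtop (ENNReal.mul_ne_top (by norm_num) ?_))
    exact (RieszKernel.lintegral_compl_ball_powKer_lt_top (by norm_num) (by linarith)).ne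
  -- the truncated field `W = 1_S w`
  set W : EuclideanSpace ℝ (Fin 3) → EuclideanSpace ℝ (Fin 3) := S.indicator w with hW
  have hWm : AEStronglyMeasurable W volume := hw.indicator measurableSet_ball
  have hWS : ∀ x, x ∉ S → W x = 0 := fun x hx => by rw [hW, indicator_of_notMem hx]
  have hW3 : ∫⁻ y, ‖(‖W y‖ ^ 2 : ℝ)‖ₑ ^ (3 / 2 : ℝ) = I3 := by
    rw [hI3, ← lintegral_indicator measurableSet_ball]
    refine lintegral_congr fun y => ?_
    rw [enorm_norm_sq_rpow_threeHalves, hW]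
    by_cases hy : y ∈ S
    · rw [indicator_of_mem hy, indicator_of_mem hy]
    · rw [indicator_of_notMem hy, indicator_of_notMem hy]
      simp
  have hW2 : MemLp (fun x => ‖W x‖ ^ 2) (3 / 2) volume := by
    refine ⟨(continuous_norm.pow 2).comp_aestronglyMeasurable hWm, ?_⟩
    exact eLpNorm_threeHalves_lt_top_of_lintegral (by rw [hW3]; exact hI3top)
  have hWi : Integrable (fun y => ‖W y‖ ^ 2) volume := by
    have h32 : (1 : ℝ≥0∞) ≤ 3 / 2 := by
      rw [ENNReal.le_div_iff_mul_le (Or.inl two_ne_zero) (Or.inl ENNReal.ofNat_ne_top)]; norm_num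
    haveI : IsFiniteMeasure ((volume : Measure (EuclideanSpace ℝ (Fin 3))).restrict (closedBall x₀ (2 * k))) :=
      ⟨by rw [Measure.restrict_apply_univ]; exact measure_closedBall_lt_top⟩
    have h1 : IntegrableOn (fun y => ‖W y‖ ^ 2) (closedBall x₀ (2 * k)) volume :=
      (hW2.restrict _).integrable h32
    exact h1.integrable_of_forall_notMem_eq_zero fun y hy => by
      simp [hWS y fun h => hy (ball_subset_closedBall h)]
  -- scales, mollified pressures, near fields
  set dn : ℕ → ℝ := fun n => ((n : ℝ) + 1)⁻¹ with hdn
  have hdn0 : ∀ n, 0 < dn n := fun n => by positivity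
  have hdn1 : ∀ n, dn n ≤ 1 := fun n => by
    rw [hdn]; exact inv_le_one_of_one_le₀ (by linarith [(n.cast_nonneg : (0 : ℝ) ≤ n)])
  set q : ℕ → EuclideanSpace ℝ (Fin 3) → ℝ := fun n =>
    Δ (newtonReg (dn n)) ⋆[ContinuousLinearMap.lsmul ℝ ℝ, volume] p with hq
  have hqc : ∀ n, Continuous (q n) := fun n =>
    (contDiff_laplacian_newtonReg_convolution (hdn0 n) hp).continuous
  set N : ℕ → EuclideanSpace ℝ (Fin 3) → ℝ := fun n c =>
    ∫ y, evalDiag (W y) (fderiv ℝ (fderiv ℝ (newtonReg (dn n))) (c - y)) with hN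
  set LPF : EuclideanSpace ℝ (Fin 3) → ℝ := fun c => localPressureFar x₀ k (fun _ => w) 0 c with hLPF
  -- (1) the key identity on `B_r(x₀)`
  set κ' : ℕ → ℝ := fun n => q n x₀ + N n x₀ with hκ'
  have hkey : ∀ n, ∀ c ∈ Br, q n c - κ' n = -N n c + LPF c := by
    intro n c hc
    have hcst := laplacian_newtonReg_convolution_add_potential_eq hw hAtop hA hp (hdn0 n)
      (fun c e => hid n c e) x₀ c
    have hsplit := potential_eq_near_sub_far (A := A) hw hAtop hA (hdn0 n) (hdn1 n) x₀ hr
      (le_refl (r + 1)) hWi hc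
    rw [hsplit] at hcst
    simp only [hκ', hq, hN, hLPF]
    linarith
  -- (2) bounds for the near field and the far field
  have hNbound : ∀ n, eLpNorm (N n) (3 / 2) volume ≤ CN * eLpNorm (fun x => ‖W x‖ ^ 2) (3 / 2) volume :=
    fun n => hCN (dn n) (hdn0 n) x₀ (2 * k) W hWm hWS hW2
  have hN32 : ∀ n, ∫⁻ c, ‖N n c‖ₑ ^ (3 / 2 : ℝ) ≤ (CN : ℝ≥0∞) ^ (3 / 2 : ℝ) * I3 := by
    intro n
    rw [lintegral_rpow_threeHalves_eq, ← hW3, lintegral_rpow_threeHalves_eq,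
      ← ENNReal.mul_rpow_of_nonneg _ _ (by norm_num)]
    exact ENNReal.rpow_le_rpow (hNbound n) (by norm_num)
  have hLPFb : ∀ c ∈ Br, ‖LPF c‖ₑ ≤ ENNReal.ofReal (CK * k) * Tail := fun c hc =>
    enorm_localPressureFar_le hCK0 hCK x₀ hk0 (fun _ => w) 0 (ball_subset_ball (by linarith) hc)
  -- (3) the constants `κ' n` are bounded
  obtain ⟨hl1c, hl1s, hl1i, -⟩ := laplacian_newtonReg_props (zero_lt_one' ℝ)
  set Λ : ℝ≥0∞ := ∫⁻ s, ‖Δ (newtonReg 1) s‖ₑ with hΛ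
  have hΛtop : Λ ≠ ⊤ := hl1i.2.ne
  have hΛn : ∀ n, ∫⁻ s, ‖Δ (newtonReg (dn n)) s‖ₑ = Λ := by
    intro n
    have h1 : ∀ {ε : ℝ}, 0 < ε → ∫⁻ s, ‖Δ (newtonReg ε) s‖ₑ = ENNReal.ofReal (∫ s, |Δ (newtonReg ε) s|) := by
      intro ε hε
      rw [ofReal_integral_eq_lintegral_ofReal (integrable_laplacian_newtonReg hε).abs
        (Eventually.of_forall fun s => abs_nonneg _)]
      refine lintegral_congr fun s => ?_
      rw [Real.enorm_eq_ofReal_abs]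
    rw [h1 (hdn0 n), hΛ, h1 one_pos, integral_abs_laplacian_newtonReg (hdn0 n),
      integral_abs_laplacian_newtonReg one_pos]
  set P1 : ℝ≥0∞ := ∫⁻ y in ball x₀ (r + 1), ‖p y‖ₑ with hP1
  have hP1top : P1 ≠ ⊤ := (hp.integrableOn_isCompact (isCompact_closedBall x₀ (r + 1))
    |>.mono_set ball_subset_closedBall).2.ne
  set Btot : ℝ≥0∞ := Λ * P1 + (volume Br + (CN : ℝ≥0∞) ^ (3 / 2 : ℝ) * I3 +
    ENNReal.ofReal (CK * k) * Tail * volume Br) with hBtot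
  have hBr_top : volume Br ≠ ⊤ := measure_ball_lt_top.ne
  have hBr_pos : volume Br ≠ 0 := (measure_ball_pos volume x₀ hr).ne'
  have hBtot_top : Btot ≠ ⊤ := by
    refine ENNReal.add_ne_top.2 ⟨ENNReal.mul_ne_top hΛtop hP1top, ENNReal.add_ne_top.2
      ⟨ENNReal.add_ne_top.2 ⟨hBr_top, ENNReal.mul_ne_top
        (ENNReal.rpow_ne_top_of_nonneg (by norm_num) ENNReal.coe_ne_top) hI3top⟩,
        ENNReal.mul_ne_top (ENNReal.mul_ne_top ENNReal.ofReal_ne_top hTailtop) hBr_top⟩⟩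
  have hone_add : ∀ x : ℝ≥0∞, x ≤ 1 + x ^ (3 / 2 : ℝ) := by
    intro x
    rcases le_or_gt x 1 with hx | hx
    · exact hx.trans le_self_add
    · calc x = x ^ (1 : ℝ) := (ENNReal.rpow_one x).symm
        _ ≤ x ^ (3 / 2 : ℝ) := ENNReal.rpow_le_rpow_of_exponent_le hx.le (by norm_num)
        _ ≤ 1 + x ^ (3 / 2 : ℝ) := le_add_self
  have hκ'bound : ∀ n, ‖κ' n‖ₑ * volume Br ≤ Btot := by
    intro n
    have hpt : ∀ c ∈ Br, ‖κ' n‖ₑ ≤ ‖q n c‖ₑ + ((1 + ‖N n c‖ₑ ^ (3 / 2 : ℝ)) + ENNReal.ofReal (CK * k) * Tail) := by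
      intro c hc
      have e1 : κ' n = q n c - (-N n c + LPF c) := by rw [← hkey n c hc]; ring
      calc ‖κ' n‖ₑ = ‖q n c - (-N n c + LPF c)‖ₑ := by rw [← e1]
        _ ≤ ‖q n c‖ₑ + ‖-N n c + LPF c‖ₑ := enorm_sub_le
        _ ≤ ‖q n c‖ₑ + (‖N n c‖ₑ + ‖LPF c‖ₑ) := by
            gcongr
            calc ‖-N n c + LPF c‖ₑ ≤ ‖-N n c‖ₑ + ‖LPF c‖ₑ := enorm_add_le _ _
              _ = ‖N n c‖ₑ + ‖LPF c‖ₑ := by rw [enorm_neg]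
        _ ≤ ‖q n c‖ₑ + ((1 + ‖N n c‖ₑ ^ (3 / 2 : ℝ)) + ENNReal.ofReal (CK * k) * Tail) :=
            add_le_add le_rfl (add_le_add (hone_add _) (hLPFb c hc))
    have hqm : AEMeasurable (fun c => ‖q n c‖ₑ) μr := (hqc n).measurable.enorm.aemeasurable
    calc ‖κ' n‖ₑ * volume Br = ∫⁻ _c in Br, ‖κ' n‖ₑ := by rw [setLIntegral_const]
      _ ≤ ∫⁻ c in Br, (‖q n c‖ₑ + ((1 + ‖N n c‖ₑ ^ (3 / 2 : ℝ)) + ENNReal.ofReal (CK * k) * Tail)) :=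
          setLIntegral_mono' measurableSet_ball hpt
      _ = (∫⁻ c in Br, ‖q n c‖ₑ) + ((volume Br + ∫⁻ c in Br, ‖N n c‖ₑ ^ (3 / 2 : ℝ)) +
            ENNReal.ofReal (CK * k) * Tail * volume Br) := by
          rw [lintegral_add_left' hqm, lintegral_add_right' _ aemeasurable_const,
            lintegral_add_left' aemeasurable_const, setLIntegral_const, setLIntegral_const, one_mul]
      _ ≤ Λ * P1 + ((volume Br + (CN : ℝ≥0∞) ^ (3 / 2 : ℝ) * I3) +
            ENNReal.ofReal (CK * k) * Tail * volume Br) := by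
          gcongr
          · calc ∫⁻ c in Br, ‖q n c‖ₑ ≤ (∫⁻ s, ‖Δ (newtonReg (dn n)) s‖ₑ) * P1 :=
                  lintegral_ball_laplacian_newtonReg_convolution_le (hdn0 n) (hdn1 n) hp x₀ r
              _ = Λ * P1 := by rw [hΛn n]
          · exact (lintegral_mono' Measure.restrict_le_self le_rfl).trans (hN32 n)
      _ = Btot := by rw [hBtot]
  set B : ℝ := (Btot / volume Br).toReal with hB
  have hκ'B : ∀ n, κ' n ∈ closedBall (0 : ℝ) B := by
    intro n
    rw [mem_closedBall_zero_iff, hB]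
    have h1 : ‖κ' n‖ₑ ≤ Btot / volume Br := by
      rw [ENNReal.le_div_iff_mul_le (Or.inl hBr_pos) (Or.inl hBr_top)]
      exact hκ'bound n
    have h2 : Btot / volume Br ≠ ⊤ := ENNReal.div_ne_top hBtot_top hBr_pos
    have h3 := ENNReal.toReal_mono h2 h1
    rwa [← ofReal_norm, ENNReal.toReal_ofReal (norm_nonneg _)] at h3
  -- (4) a convergent subsequence of the constants, and the a.e. convergence of the mollifications
  obtain ⟨κ, -, φ, hφ, hκlim⟩ := tendsto_subseq_of_bounded Metric.isBounded_closedBall hκ'B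
  have hq_ae : ∀ᵐ c ∂μr, Tendsto (fun j => q (φ j) c) atTop (𝓝 (p c)) := by
    have h := ae_tendsto_laplacian_newtonReg_convolution hp
    refine ae_restrict_of_ae (h.mono fun c hc => ?_)
    exact hc.comp hφ.tendsto_atTop
  refine ⟨κ, ?_⟩
  -- (5) Fatou
  set g : ℕ → EuclideanSpace ℝ (Fin 3) → ℝ≥0∞ := fun j c => ‖q (φ j) c - κ' (φ j)‖ₑ ^ (3 / 2 : ℝ) with hg
  have hgm : ∀ j, AEMeasurable (g j) μr := fun j =>
    (((hqc _).sub continuous_const).measurable.enorm.pow_const _).aemeasurable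
  have hglim : ∀ᵐ c ∂μr, Tendsto (fun j => g j c) atTop (𝓝 (‖p c - κ‖ₑ ^ (3 / 2 : ℝ))) := by
    filter_upwards [hq_ae] with c hc
    have h1 : Tendsto (fun j => q (φ j) c - κ' (φ j)) atTop (𝓝 (p c - κ)) := hc.sub hκlim
    exact ((ENNReal.continuous_rpow_const.tendsto _).comp ((continuous_enorm.tendsto _).comp h1))
  have hFatou : ∫⁻ c in Br, ‖p c - κ‖ₑ ^ (3 / 2 : ℝ) ≤ liminf (fun j => ∫⁻ c in Br, g j c) atTop := by
    calc ∫⁻ c in Br, ‖p c - κ‖ₑ ^ (3 / 2 : ℝ) = ∫⁻ c in Br, liminf (fun j => g j c) atTop :=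
          lintegral_congr_ae (hglim.mono fun c hc => hc.liminf_eq.symm)
      _ ≤ liminf (fun j => ∫⁻ c in Br, g j c) atTop := lintegral_liminf_le' hgm
  -- the bound for each `j`
  have hgbound : ∀ j, ∫⁻ c in Br, g j c ≤ RHS := by
    intro j
    have hpt : ∀ c ∈ Br, g j c ≤ (2 : ℝ≥0∞) ^ (1 / 2 : ℝ) *
        (‖N (φ j) c‖ₑ ^ (3 / 2 : ℝ) + (ENNReal.ofReal (CK * k) * Tail) ^ (3 / 2 : ℝ)) := by
      intro c hc
      rw [hg]
      dsimp only
      rw [hkey (φ j) c hc]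
      calc ‖-N (φ j) c + LPF c‖ₑ ^ (3 / 2 : ℝ) ≤ (‖N (φ j) c‖ₑ + ENNReal.ofReal (CK * k) * Tail) ^ (3 / 2 : ℝ) := by
            refine ENNReal.rpow_le_rpow ?_ (by norm_num)
            calc ‖-N (φ j) c + LPF c‖ₑ ≤ ‖-N (φ j) c‖ₑ + ‖LPF c‖ₑ := enorm_add_le _ _
              _ ≤ ‖N (φ j) c‖ₑ + ENNReal.ofReal (CK * k) * Tail := by
                  rw [enorm_neg]; exact add_le_add le_rfl (hLPFb c hc)
        _ ≤ _ := add_rpow_threeHalves_le _ _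
    calc ∫⁻ c in Br, g j c ≤ ∫⁻ c in Br, (2 : ℝ≥0∞) ^ (1 / 2 : ℝ) *
          (‖N (φ j) c‖ₑ ^ (3 / 2 : ℝ) + (ENNReal.ofReal (CK * k) * Tail) ^ (3 / 2 : ℝ)) :=
          setLIntegral_mono' measurableSet_ball hpt
      _ = (2 : ℝ≥0∞) ^ (1 / 2 : ℝ) * ((∫⁻ c in Br, ‖N (φ j) c‖ₑ ^ (3 / 2 : ℝ)) +
            (ENNReal.ofReal (CK * k) * Tail) ^ (3 / 2 : ℝ) * volume Br) := by
          rw [lintegral_const_mul' _ _ (ENNReal.rpow_ne_top_of_nonneg (by norm_num) ENNReal.ofNat_ne_top),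
            lintegral_add_right' _ aemeasurable_const, setLIntegral_const]
      _ ≤ RHS := by
          rw [hRHS, mul_comm ((ENNReal.ofReal (CK * k) * Tail) ^ (3 / 2 : ℝ)) (volume Br)]
          gcongr
          exact (lintegral_mono' Measure.restrict_le_self le_rfl).trans (hN32 _)
  exact hFatou.trans (liminf_le_of_frequently_le' (Frequently.of_forall hgbound))

end Slice

end Literature.Analysis.FluidPDE
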